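/-
Copyright: cell pub-balaban-gaps (YM BLITZ Y1, track G1), seat g1-p2 GEN 4 (unit `pub-balaban-gaps-g1-p2`).  Row (D4) NODE O,
OBJECT ∕ MECHANISM level: the NEUMANN ∕ INVERSE step of the walk-expansion calculus ([B9] (3.130), p. 422) at the level of the
FULL `JointWalkExpansion` shape (σ-structure + termwise analyticity + reduced-rate window), BY NAME over ne5's T9
`Spine.NE5.NeumannPencilCovariance.walkMajorants_inv_pencil` (run TWICE: at the per-term rate and at the window rate) and the
tree's chain geometry `B9SectDWalk.through_chainDist_mem ∕ _seed`.  HONEST FRAMING: bookkeeping over landed hypothesis SHAPES;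
nothing of Bałaban's constructed or asserted; (D4) NOT discharged (instance 0∕1); NOT BetaPertH, NOT continuum, NOT Clay.
-/
import Summits.QuantumFields.BalabanUV.T4Continuum.Spine.NE5.NeumannPencilCovariance
import Summits.QuantumFields.BalabanUV.Gaps.D4WalkProduct

/-!
# `Gaps.D4WalkNeumann` — the inverse `(A + tP)⁻¹` of a walk-expanded pencil is a JOINT walk expansion (cell pub-balaban-gaps,
# seat g1-p2 gen 4)

HONEST DEPENDENCY (cell pub-balaban, verbatim): continuum YM on T⁴ ⇐ BetaPertH ∧ nine spine estimates (0/9 proved);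
BetaPertH ⇐ (D1) ∧ (D4) ∧ CAP+tail.

[B9] (3.130) p. 421 *"G = G₀(I − Δ′_πG₀)⁻¹ = Σ_{n=0}^∞ G₀(Δ′_πG₀)ⁿ"* and p. 422 *"Of course Theorem 3.10 holds also because we
replace each operator in (3.130) by its random walk expansion … each operator Δ′_π provides the small factor"*.  ne5's T9
(`walkMajorants_inv_pencil`, p-id at its LANDED line) kernel-checks this sentence at the ENTRY level for the pencil
`(A + tP)⁻¹ = Σ_N (−tCP)^N C` (`A·C = 1`): the chains `T_C(ω₂)(−tT_P(ω₁)) ⋯ T_C(ω₀)` are a `WalkMajorants` family — `hasSum`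
by level sums + telescoping, `maj` by `norm_chain_entry_le`, `majSum` by `majSumLe_chain` (ONE chain rate for every length,
smallness `q = (mc₁)²K̄_C(τK̄_P)c′² < 1`, constant `K̄_C(1 − q)⁻¹`), all letters t-independent.  THIS FILE lifts it to the
(D4) NODE-O object `JointWalkExpansion` (`B13JointWalkExpansion`), i.e. to the Γ-kernel ∕ precision slots of `TermWalkData`:
* the REDUCED-RATE WINDOW: T9's hypotheses constrain the chain rate `ρ` to an INTERVAL while its chain family, amplitudes,
  distances and constant do not mention `ρ` — so running T9 at `ρ` gives `hasSum`∕`maj` and running it at `ρ − ε` gives the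
  `majSum` field (g1-plan-1 (W-c) «two runs ⟹ one window», ne5 [W-ne5-g5-1]); the window `ε` must fit inside BOTH factors'
  windows: `ρ_C − ε_C ≤ ρ − ε`, `ρ_P − ε_P ≤ ρ − ε`;
* `termAnalytic`: a chain entry is an iterated finite sum of products of functions complex-differentiable on the ball
  (`differentiableOn_neumannChain`: `D4WalkProduct.differentiableOn_mul_entry` + list induction);
* `indep`: a chain all of whose factors are σ-free is σ-free (list induction on `JointWalkExpansion.indep`);
* `through`: a chain with a σ-carrying seed ∕ step has a chain distance passing through `X` (`through_chainDist_seed ∕ _mem`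
  with `through_infConv_left ∕ _right` for the step `D_C □ D_P`);
* `D_nonneg`: `NeumannChainWalks.chainDist_nonneg`.
THEOREM `jointWalkExpansion_inv_pencil`.  COROLLARY `jointWalkExpansion_inv` (`t = 1`, `τ = 1`: the inverse of `A + P`).
RATE LEDGER (plan-1 L-2): the Neumann family costs ONE row-sum rate `σ₁` twice (`ρ + σ₁ ≤ ρ_s ≤ ρ_C`, `ρ_s + σ₁ ≤ ρ_P`) and
one torus-rate step `σ′` twice (`κ + σ′ ≤ κ_s ≤ κ_P`, `κ_s + σ′ ≤ κ_C`), ONCE for all chain lengths — not per factor.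
Value: kernel-checked bookkeeping over landed SHAPES, NOT summit progress; nothing of Bałaban's asserted; words of row (D4) UNCHANGED.
-/

noncomputable section

namespace Summit.QuantumFields.BalabanUV.Gaps.D4WalkNeumann

open Metric Set Finset
open Literature.MathematicalPhysics.QuantumFieldTheory.Balaban1983to89
open Literature.MathematicalPhysics.QuantumFieldTheory.Balaban1983to89.B9SectDWalk
  (Through MajSumLe DomBy infConv chainConst chainDist domBy_infConv domBy_chainDist through_chainDist_seed
    through_chainDist_mem through_infConv_left through_infConv_right)
open Literature.MathematicalPhysics.QuantumFieldTheory.Balaban1983to89.B9Thm34Ext (toB6)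
open Literature.MathematicalPhysics.QuantumFieldTheory.Balaban1983to89.B9Thm37GlueTorus
  (torusGeom tdist1 tdist1_nonneg hdnn_torusGeom htri_torusGeom)
open Literature.MathematicalPhysics.QuantumFieldTheory.Balaban1983to89.TreeLengthTorus (TPt)
open Literature.MathematicalPhysics.QuantumFieldTheory.Balaban1983to89.B5TorusCover (UT)
open Literature.MathematicalPhysics.QuantumFieldTheory.Balaban1983to89.B11SectG (RowSum)
open Literature.MathematicalPhysics.QuantumFieldTheory.Balaban1983to89.B13JointWalkExpansion (JointWalkExpansion WalkMajorants)
open Summit.QuantumFields.BalabanUV.T4Continuum.Spine.NE5.NeumannChainWalks (chainDist_nonneg)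
open Summit.QuantumFields.BalabanUV.T4Continuum.Spine.NE5.NeumannPencilCovariance (walkMajorants_inv_pencil)
open Summit.QuantumFields.BalabanUV.Gaps.D4WalkProduct (differentiableOn_mul_entry)

variable {ν : ℕ} {Nf : Fin ν → ℕ} [∀ i, NeZero (Nf i)]
variable {d N' : ℕ} {n : Type} [Fintype n] [DecidableEq n]
variable {E : Type*} [NormedAddCommGroup E] [NormedSpace ℂ E]

/-! ## §1. Chains of matrix families: termwise analyticity and σ-independence by list induction -/

omit [Fintype n] [DecidableEq n] in
/-- Entries of a scalar multiple of an entrywise-differentiable matrix family are differentiable. -/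
theorem differentiableOn_smul_entry {M : E → Matrix n n ℂ} {s : Set E} (c : ℂ)
    (hM : ∀ k j, DifferentiableOn ℂ (fun u => M u k j) s) (k j : n) :
    DifferentiableOn ℂ (fun u => (c • M u) k j) s := by
  simpa only [Matrix.smul_apply, smul_eq_mul] using (hM k j).const_mul c

omit [DecidableEq n] in
/-- **Termwise analyticity of the Neumann chains** (the `termAnalytic` field of §2, in its literal shape): every chain
`T_C(ω₂)(−tT_P(ω₁)) ⋯ T_C(ω₀)` has entries complex-differentiable in the configuration on the ball when the factors' terms do —
finite sums of products, `D4WalkProduct.differentiableOn_mul_entry`, induction on the list ([II] p. 15; [B9] Thm 3.10: a term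
is a finite product of local operators). -/
theorem differentiableOn_neumannChain {c₀ : B13.Consts} {WC WP : Type}
    {TC : WC → (TPt d N' → ℂ) → E → Matrix n n ℂ} {TP : WP → (TPt d N' → ℂ) → E → Matrix n n ℂ} {R : ℝ}
    (hTC : ∀ ω, ∀ σ₀ : TPt d N' → ℂ, (∀ j, ‖σ₀ j‖ ≤ Real.exp c₀.κ₁) →
      ∀ i j, DifferentiableOn ℂ (fun u => TC ω σ₀ u i j) (ball (0 : E) R))
    (hTP : ∀ ω, ∀ σ₀ : TPt d N' → ℂ, (∀ j, ‖σ₀ j‖ ≤ Real.exp c₀.κ₁) →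
      ∀ i j, DifferentiableOn ℂ (fun u => TP ω σ₀ u i j) (ball (0 : E) R))
    (t : ℂ) (σ₀ : TPt d N' → ℂ) (hσ₀ : ∀ j, ‖σ₀ j‖ ≤ Real.exp c₀.κ₁) (ω₀ : WC) :
    ∀ (l : List (WC × WP)) (a b : n), DifferentiableOn ℂ
      (fun u => (l.foldr (fun i M => (TC i.1 σ₀ u * ((-t) • TP i.2 σ₀ u)) * M) (TC ω₀ σ₀ u)) a b) (ball (0 : E) R) := by
  intro l
  induction l with
  | nil => intro a b; simpa only [List.foldr_nil] using hTC ω₀ σ₀ hσ₀ a b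
  | cons i l ih =>
      intro a b
      simp only [List.foldr_cons]
      exact differentiableOn_mul_entry (M₁ := fun u => TC i.1 σ₀ u * ((-t) • TP i.2 σ₀ u))
        (M₂ := fun u => l.foldr (fun i M => (TC i.1 σ₀ u * ((-t) • TP i.2 σ₀ u)) * M) (TC ω₀ σ₀ u))
        (fun a k => differentiableOn_mul_entry (M₁ := fun u => TC i.1 σ₀ u) (M₂ := fun u => (-t) • TP i.2 σ₀ u)
          (hTC i.1 σ₀ hσ₀) (differentiableOn_smul_entry (-t) (hTP i.2 σ₀ hσ₀)) a k) ih a b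

omit [Fintype n] [DecidableEq n] in
/-- Two chains with the same steps along the list and the same seed agree (used for σ-independence: every factor of a σ-free
chain takes its `σ = 0` value). -/
theorem chain_congr {ι : Type} [Fintype n] {S S' : ι → Matrix n n ℂ} {T T' : Matrix n n ℂ} :
    ∀ (l : List ι), (∀ i ∈ l, S i = S' i) → T = T' →
      l.foldr (fun i M => S i * M) T = l.foldr (fun i M => S' i * M) T' := by
  intro l
  induction l with
  | nil => intro _ hT; simpa using hT
  | cons i l ih =>
      intro hS hT
      simp only [List.foldr_cons]
      rw [hS i (by simp), ih (fun j hj => hS j (by simp [hj])) hT]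

/-! ## §2. The inverse of a walk-expanded pencil is a joint walk expansion -/

variable {c₀ : B13.Consts} {locn : n → UT Nf} {X : Finset (UT Nf)}
variable {WC WP : Type}
variable {TC : WC → (TPt d N' → ℂ) → E → Matrix n n ℂ} {Cm : (TPt d N' → ℂ) → E → Matrix n n ℂ}
variable {SXC : Set WC} {AC : WC → ℝ} {DC : WC → UT Nf → UT Nf → ℝ}
variable {TP : WP → (TPt d N' → ℂ) → E → Matrix n n ℂ} {Pm : (TPt d N' → ℂ) → E → Matrix n n ℂ}
variable {SXP : Set WP} {AP : WP → ℝ} {DP : WP → UT Nf → UT Nf → ℝ}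
variable {A : (TPt d N' → ℂ) → E → Matrix n n ℂ}
variable {R ρC εC κC KbarC ρP εP κP KbarP ρ ε ρs σ₁ c₁ σ' c' κs κ τ : ℝ} {m : ℕ} {t : ℂ}

/-- **THE INVERSE OF A WALK-EXPANDED PENCIL IS A JOINT WALK EXPANSION** ([B9] (3.130) ∕ p. 422 at the FULL NODE-O shape).
Data: joint walk expansions of `C` (`A·C = 1` on polydisc × ball; per-term rate `ρ_C`, window `ε_C`, torus rate `κ_C`,
constant `K̄_C`, σ-carrying sub-family `SX_C`) and of the pencil direction `P` (`ρ_P, ε_P, κ_P, K̄_P, SX_P`), the same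
σ-region `X` and ball, all walk distances dominating `d₁`, fibre `m`, row sums `(σ₁,c₁)`, `(σ′,c′)`.  Rates: a chain rate `ρ`
and window `ε` with `0 ≤ ε ≤ ρ`, `ρ + σ₁ ≤ ρ_s ≤ ρ_C`, `ρ_s + σ₁ ≤ ρ_P`, and BOTH factor windows containing the chain window,
`ρ_C − ε_C ≤ ρ − ε`, `ρ_P − ε_P ≤ ρ − ε`; torus rates `0 ≤ κ`, `κ + σ′ ≤ κ_s ≤ κ_P`, `κ_s + σ′ ≤ κ_C`, `κ ≤ κ_C`; `‖t‖ ≤ τ`; the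
MARGIN SMALLNESS `q = (mc₁)·((mc₁)K̄_C(τK̄_P)c′)·c′ < 1`.  Conclusion: `(σ,u) ↦ (A(σ,u) + tP(σ,u))⁻¹` is a `JointWalkExpansion`
with the Neumann chains as terms, σ-carrying sub-family «seed or some step carries σ», amplitudes `chainConst`, distances
`chainDist` of the steps `D_C □ D_P` over the seed `D_C`, rate `ρ`, window `ε`, torus rate `κ`, constant `K̄_C(1 − q)⁻¹` — every
letter independent of `t` and of the torus.  `hasSum ∕ maj ∕ A_nonneg` = T9 at rate `ρ`; `majSum` = T9 at rate `ρ − ε`;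
`termAnalytic ∕ indep ∕ through ∕ D_nonneg` = §1 + the chain geometry. [cite: Balaban1985BackgroundPropagators, (3.130) p.421, p.422, (3.107)–(3.108) p.416, (3.93) p.410; Balaban1988RG2Cluster, (1.11) p.5, p.13, p.15] -/
theorem jointWalkExpansion_inv_pencil
    (hC : JointWalkExpansion c₀ locn locn Cm X R εC κC KbarC TC SXC AC DC ρC)
    (hP : JointWalkExpansion c₀ locn locn Pm X R εP κP KbarP TP SXP AP DP ρP)
    (hCdom : ∀ ω, DomBy (toB6 (torusGeom Nf 0 0 0) 0 True) (DC ω))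
    (hPdom : ∀ ω, DomBy (toB6 (torusGeom Nf 0 0 0) 0 True) (DP ω))
    (hAC : ∀ σ₀ : TPt d N' → ℂ, (∀ j, ‖σ₀ j‖ ≤ Real.exp c₀.κ₁) → ∀ u ∈ ball (0 : E) R, A σ₀ u * Cm σ₀ u = 1)
    (hfib : ∀ y : UT Nf, (Finset.univ.filter fun k => locn k = y).card ≤ m)
    (hrow : RowSum (toB6 (torusGeom Nf 0 0 0) 0 True) σ₁ c₁) (hrow' : RowSum (toB6 (torusGeom Nf 0 0 0) 0 True) σ' c')
    (hσ₁ : 0 ≤ σ₁) (hσ' : 0 ≤ σ') (hc₁ : 0 ≤ c₁) (hc' : 0 ≤ c')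
    (hε : 0 ≤ ε) (hερ : ε ≤ ρ) (hρs : ρ + σ₁ ≤ ρs) (hρsC : ρs ≤ ρC) (hρsP : ρs + σ₁ ≤ ρP)
    (hwC : ρC - εC ≤ ρ - ε) (hwP : ρP - εP ≤ ρ - ε)
    (hKC : 0 ≤ KbarC) (hKP : 0 ≤ KbarP)
    (hκs : 0 ≤ κs) (hκsP : κs ≤ κP) (hκsC : κs + σ' ≤ κC) (hκ : 0 ≤ κ) (hκC : κ ≤ κC) (hκκs : κ + σ' ≤ κs)
    (hτ : 0 ≤ τ) (ht : ‖t‖ ≤ τ)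
    (hq : (m * c₁) * ((m * c₁) * KbarC * (τ * KbarP) * c') * c' < 1) :
    JointWalkExpansion c₀ locn locn (fun σ₀ u => (A σ₀ u + t • Pm σ₀ u)⁻¹) X R ε κ
      (KbarC * (1 - (m * c₁) * ((m * c₁) * KbarC * (τ * KbarP) * c') * c')⁻¹)
      (fun (p : List (WC × WP) × WC) σ₀ u =>
        p.1.foldr (fun i M => (TC i.1 σ₀ u * ((-t) • TP i.2 σ₀ u)) * M) (TC p.2 σ₀ u))
      {p | p.2 ∈ SXC ∨ ∃ i ∈ p.1, i.1 ∈ SXC ∨ i.2 ∈ SXP}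
      (fun p => chainConst (m : ℝ) c₁ (fun i : WC × WP => (m * c₁) * (AC i.1 * (τ * AP i.2))) (AC p.2) p.1)
      (fun p => chainDist (g := toB6 (torusGeom Nf 0 0 0) 0 True)
        (fun i : WC × WP => infConv (g := toB6 (torusGeom Nf 0 0 0) 0 True) (DC i.1) (DP i.2)) (DC p.2) p.1) ρ := by
  have hρ : 0 ≤ ρ := hε.trans hερ
  have hrC : ρC - εC ≤ ρ := hwC.trans (sub_le_self ρ hε)
  have hrP : ρP - εP ≤ ρ := hwP.trans (sub_le_self ρ hε)
  -- T9 at the per-term rate ρ: hasSum, maj, A_nonneg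
  have h1 := walkMajorants_inv_pencil (A := A) hC.hasSum hC.maj hC.majSum hCdom hC.A_nonneg hP.hasSum hP.maj hP.majSum
    hPdom hP.A_nonneg hAC hfib hrow hrow' hσ₁ hσ' hc₁ hc' hρ hρs hρsC hρsP hrC hrP hKC hKP hκs hκsP hκsC hκ hκC hκκs hτ ht hq
  -- T9 at the window rate ρ − ε: majSum
  have h2 := walkMajorants_inv_pencil (A := A) (ρ := ρ - ε) (ρs := ρs - ε) hC.hasSum hC.maj hC.majSum hCdom hC.A_nonneg
    hP.hasSum hP.maj hP.majSum hPdom hP.A_nonneg hAC hfib hrow hrow' hσ₁ hσ' hc₁ hc' (sub_nonneg.2 hερ) (by linarith)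
    (by linarith) (by linarith) hwC hwP hKC hKP hκs hκsP hκsC hκ hκC hκκs hτ ht hq
  -- the step distances dominate d₁; steps through X when a factor carries σ
  have hDstep : ∀ i : WC × WP, DomBy (toB6 (torusGeom Nf 0 0 0) 0 True)
      (infConv (g := toB6 (torusGeom Nf 0 0 0) 0 True) (DC i.1) (DP i.2)) :=
    fun i => domBy_infConv (htri_torusGeom 0 0 0 0 True) (hCdom i.1) (hPdom i.2)
  exact
  { hasSum := h1.hasSum
    termAnalytic := fun p σ₀ hσ₀ a b => differentiableOn_neumannChain hC.termAnalytic hP.termAnalytic t σ₀ hσ₀ p.2 p.1 a b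
    maj := h1.maj
    majSum := h2.majSum
    indep := fun p hp σ₀ hσ₀ => by
      simp only [Set.mem_setOf_eq, not_or, not_exists, not_and] at hp
      refine chain_congr p.1 (fun i hi => ?_) (hC.indep p.2 hp.1 σ₀ hσ₀)
      obtain ⟨hi1, hi2⟩ := hp.2 i hi
      rw [hC.indep i.1 hi1 σ₀ hσ₀, hP.indep i.2 hi2 σ₀ hσ₀]
    through := fun p hp => by
      rcases hp with hseed | ⟨i, hi, hstep⟩
      · exact through_chainDist_seed (htri_torusGeom 0 0 0 0 True) hDstep (hC.through p.2 hseed) p.1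
      · refine through_chainDist_mem (htri_torusGeom 0 0 0 0 True) hDstep (hCdom p.2) ?_ p.1 hi
        rcases hstep with h | h
        · exact through_infConv_left (htri_torusGeom 0 0 0 0 True) (hC.through i.1 h) (hPdom i.2)
        · exact through_infConv_right (htri_torusGeom 0 0 0 0 True) (hCdom i.1) (hP.through i.2 h)
    A_nonneg := h1.A_nonneg
    D_nonneg := fun p a b => chainDist_nonneg hDstep (hCdom p.2) p.1 a b }

/-- **Domination for the Neumann family's walk distances** (so the inverse can be multiplied ∕ inverted again: the `hdom`
input of `D4WalkProduct.jointWalkExpansion_mul` and of this file). [cite: Balaban1984PropagatorsII, (2.54) p.233; Balaban1985BackgroundPropagators, (3.93) p.410] -/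
theorem domBy_chain (hCdom : ∀ ω, DomBy (toB6 (torusGeom Nf 0 0 0) 0 True) (DC ω))
    (hPdom : ∀ ω, DomBy (toB6 (torusGeom Nf 0 0 0) 0 True) (DP ω)) (p : List (WC × WP) × WC) :
    DomBy (toB6 (torusGeom Nf 0 0 0) 0 True) (chainDist (g := toB6 (torusGeom Nf 0 0 0) 0 True)
      (fun i : WC × WP => infConv (g := toB6 (torusGeom Nf 0 0 0) 0 True) (DC i.1) (DP i.2)) (DC p.2) p.1) :=
  domBy_chainDist (htri_torusGeom 0 0 0 0 True)
    (fun i => domBy_infConv (htri_torusGeom 0 0 0 0 True) (hCdom i.1) (hPdom i.2)) (hCdom p.2) p.1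

/-- **COROLLARY — the inverse of `A + P`** (`t = 1`, `τ = 1`): same data, smallness `q = (mc₁)²K̄_CK̄_Pc′² < 1`.  This is the
form the precision slot `A2 = 1 − H` of a model term uses (`A = C = 1`, `P = −H`): see `Gaps/D4WalkModelAcross`.
[cite: Balaban1985BackgroundPropagators, (3.130) p.421, p.422] -/
theorem jointWalkExpansion_inv
    (hC : JointWalkExpansion c₀ locn locn Cm X R εC κC KbarC TC SXC AC DC ρC)
    (hP : JointWalkExpansion c₀ locn locn Pm X R εP κP KbarP TP SXP AP DP ρP)
    (hCdom : ∀ ω, DomBy (toB6 (torusGeom Nf 0 0 0) 0 True) (DC ω))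
    (hPdom : ∀ ω, DomBy (toB6 (torusGeom Nf 0 0 0) 0 True) (DP ω))
    (hAC : ∀ σ₀ : TPt d N' → ℂ, (∀ j, ‖σ₀ j‖ ≤ Real.exp c₀.κ₁) → ∀ u ∈ ball (0 : E) R, A σ₀ u * Cm σ₀ u = 1)
    (hfib : ∀ y : UT Nf, (Finset.univ.filter fun k => locn k = y).card ≤ m)
    (hrow : RowSum (toB6 (torusGeom Nf 0 0 0) 0 True) σ₁ c₁) (hrow' : RowSum (toB6 (torusGeom Nf 0 0 0) 0 True) σ' c')
    (hσ₁ : 0 ≤ σ₁) (hσ' : 0 ≤ σ') (hc₁ : 0 ≤ c₁) (hc' : 0 ≤ c')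
    (hε : 0 ≤ ε) (hερ : ε ≤ ρ) (hρs : ρ + σ₁ ≤ ρs) (hρsC : ρs ≤ ρC) (hρsP : ρs + σ₁ ≤ ρP)
    (hwC : ρC - εC ≤ ρ - ε) (hwP : ρP - εP ≤ ρ - ε)
    (hKC : 0 ≤ KbarC) (hKP : 0 ≤ KbarP)
    (hκs : 0 ≤ κs) (hκsP : κs ≤ κP) (hκsC : κs + σ' ≤ κC) (hκ : 0 ≤ κ) (hκC : κ ≤ κC) (hκκs : κ + σ' ≤ κs)
    (hq : (m * c₁) * ((m * c₁) * KbarC * (1 * KbarP) * c') * c' < 1) :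
    JointWalkExpansion c₀ locn locn (fun σ₀ u => (A σ₀ u + (1 : ℂ) • Pm σ₀ u)⁻¹) X R ε κ
      (KbarC * (1 - (m * c₁) * ((m * c₁) * KbarC * (1 * KbarP) * c') * c')⁻¹)
      (fun (p : List (WC × WP) × WC) σ₀ u =>
        p.1.foldr (fun i M => (TC i.1 σ₀ u * ((-(1 : ℂ)) • TP i.2 σ₀ u)) * M) (TC p.2 σ₀ u))
      {p | p.2 ∈ SXC ∨ ∃ i ∈ p.1, i.1 ∈ SXC ∨ i.2 ∈ SXP}
      (fun p => chainConst (m : ℝ) c₁ (fun i : WC × WP => (m * c₁) * (AC i.1 * (1 * AP i.2))) (AC p.2) p.1)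
      (fun p => chainDist (g := toB6 (torusGeom Nf 0 0 0) 0 True)
        (fun i : WC × WP => infConv (g := toB6 (torusGeom Nf 0 0 0) 0 True) (DC i.1) (DP i.2)) (DC p.2) p.1) ρ :=
  jointWalkExpansion_inv_pencil hC hP hCdom hPdom hAC hfib hrow hrow' hσ₁ hσ' hc₁ hc' hε hερ hρs hρsC hρsP hwC hwP hKC hKP
    hκs hκsP hκsC hκ hκC hκκs zero_le_one (by simp) hq

end Summit.QuantumFields.BalabanUV.Gaps.D4WalkNeumann

end
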